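import Summits.Parity.GeneralizedHardyLittlewood.Theorems.GoldbachHeathBrownDispersionAssembly
import Summits.Parity.GeneralizedHardyLittlewood.Theorems.GoldbachHeathBrownDispersionClassTransfer
import Summits.Parity.GeneralizedHardyLittlewood.Theorems.GoldbachHeathBrownDispersionModelDispersion
import Summits.Parity.GeneralizedHardyLittlewood.Theorems.GoldbachHeathBrownDispersionModelMainTerm
import Summits.Parity.GeneralizedHardyLittlewood.Theorems.GoldbachHeathBrownDispersionFourierSideComparison
import Summits.Parity.GeneralizedHardyLittlewood.Theorems.GoldbachHeathBrownDispersionHeathBrownMorozUniformOfSplit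
import Summits.Parity.GeneralizedHardyLittlewood.Theorems.GoldbachHeathBrownDispersionShiftInvariance
import HarnessLib

/-!
# Route `GoldbachHeathBrownDispersion` — the target from the last open crux (stmt-Parity-19908 modulo stmt-Parity-19915 / stmt-Parity-20702)

Helper file (`--supports stmt-Parity-19908`).  Every item of route `route-Parity-GoldbachHeathBrownDispersion`
(Line C, FRONTIER formalisation rung F-P1b) is proved in the tree EXCEPT the crux K1
`HeathBrownMorozUniform` (stmt-Parity-19915; Heath-Brown–Moroz 2004, Theorem 2 for `x³ + 2y³`, finite-uniform
form) — equivalently its split child `RangeKernelReduced` (stmt-Parity-20702), the glue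
`HeathBrownMorozUniformOfSplit` (stmt-Parity-20704) and `ShiftInvariance` (stmt-Parity-20703) being proved.
This file composes the landed proofs once, so that the target closes by ONE application the moment K1 lands:

* `goldbachHeathBrownAlmostAll_of_heathBrownMorozUniform : HeathBrownMorozUniform → GoldbachHeathBrownAlmostAll`
  — the route's deciding theorem `closes` fed with `goldbachHeathBrownDispersion_assembly_proof` (stmt-Parity-19914),
  `…_classTransfer_proof` (stmt-Parity-20359), `…_modelDispersion_proof` (stmt-Parity-19917),
  `…_modelMainTerm_proof` (stmt-Parity-19918), `…_fourierSideComparison_proof` (stmt-Parity-19913);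
* `heathBrownMorozUniform_of_rangeKernelReduced : RangeKernelReduced → HeathBrownMorozUniform` — the landed
  glue `…_heathBrownMorozUniformOfSplit_proof` with `…_shiftInvariance_proof`;
* `goldbachHeathBrownAlmostAll_of_rangeKernelReduced : RangeKernelReduced → GoldbachHeathBrownAlmostAll`.

**Honesty.** Nothing here proves K1, and nothing here bears on the binary Goldbach problem itself: the target
`GoldbachHeathBrownAlmostAll` is an ALMOST-ALL statement for `n = p + (x³ + 2y³)` with both summands prime
(a thin cubic prime summand), the registered rung leaf of F-P1b — conditional here on K1.

References: [cite: HeathBrownMoroz2004, Theorem 2]; [cite: MontgomeryVaughan1975, §7].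
-/

namespace Summit.Parity.GeneralizedHardyLittlewood.Theorems

open Summit.Parity.GeneralizedHardyLittlewood.Theses.GoldbachHeathBrownDispersion

/-- **The target modulo K1**: `HeathBrownMorozUniform → GoldbachHeathBrownAlmostAll` — the route's deciding
theorem `closes` applied to the landed `Assembly` and the four landed blocks `ClassTransfer`,
`ModelDispersion`, `ModelMainTerm`, `FourierSideComparison`. [cite: MontgomeryVaughan1975, §7] -/
theorem goldbachHeathBrownAlmostAll_of_heathBrownMorozUniform (h₁ : HeathBrownMorozUniform) :
    GoldbachHeathBrownAlmostAll :=
  closes goldbachHeathBrownDispersion_assembly_proof h₁ goldbachHeathBrownDispersion_classTransfer_proof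
    goldbachHeathBrownDispersion_modelDispersion_proof goldbachHeathBrownDispersion_modelMainTerm_proof
    goldbachHeathBrownDispersion_fourierSideComparison_proof

/-- **K1 from its split child**: `RangeKernelReduced → HeathBrownMorozUniform` — the landed glue
`HeathBrownMorozUniformOfSplit` (stmt-Parity-20704) with the landed `ShiftInvariance` (stmt-Parity-20703).
[cite: HeathBrownMoroz2004, Theorem 2] -/
theorem heathBrownMorozUniform_of_rangeKernelReduced (h : RangeKernelReduced) : HeathBrownMorozUniform :=
  goldbachHeathBrownDispersion_heathBrownMorozUniformOfSplit_proof h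
    goldbachHeathBrownDispersion_shiftInvariance_proof

/-- **The target modulo the split child**: `RangeKernelReduced → GoldbachHeathBrownAlmostAll`.
[cite: HeathBrownMoroz2004, Theorem 2] [cite: MontgomeryVaughan1975, §7] -/
theorem goldbachHeathBrownAlmostAll_of_rangeKernelReduced (h : RangeKernelReduced) :
    GoldbachHeathBrownAlmostAll :=
  goldbachHeathBrownAlmostAll_of_heathBrownMorozUniform (heathBrownMorozUniform_of_rangeKernelReduced h)

end Summit.Parity.GeneralizedHardyLittlewood.Theorems
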